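import Mathlib
import HarnessLib
import HarnessLib.Audit
import Summits.CriticalPhenomena.PercolationContinuityZ3.Theorems.PercNearOneGluingNoHeavyLowerTailHexMSMatchSecondDiff

/-!
# The pure SC inequality (Π2″) for Marica–Schönheim-tight blocks, any number of blockers (hp-7 gen 72)

Support file for crux `stmt-CriticalPhenomena-4575` (route `PercNearOneGluingNoHeavy`), hull-port seat `prim-hp-7` (generation 72);
`--supports stmt-CriticalPhenomena-4575`.  No `sorry`.  Memo: `run/shared/lean/prim/prim-hp-7/FROM-prim-hp-7-g72-MS2.md` §0.

`PureSC` (`…HexMSMatchPureSC`) asks, for a complement-free family `F = P ⊔ Q` and a family `W` of blocker representatives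
`p \ q`, `p ∪ (U \ q)` avoiding `cl(P \\ P ∪ Q \\ Q)` and `cl F`, that `2 (#P + #Q + #W) ≤ #cl(scTerms P Q W)`.  Gen 71 proved
`#W = 1` (`…HexMSMatchPureSCOne`).  Using the tight core of `…HexMSMatchSecondDiff` (second-difference reduction + pivot fibres):

* `two_mul_card_le_card_clU_scTerms_of_tight_or_free` — **(Π2″) for dead-like blocks whenever `F = P ⊔ Q` is MS-tight or has
  MS-excess `≥ #W`** (any number of blockers): `2 (#P + #Q + #W) ≤ #clU U (scTerms P Q W)`.  Dead-like = pairwise intersecting and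
  non-covering in `U`, as dead families of antipodal instances are; then members and their complements avoid `cl(F \\ F)`.
  Proof: the differences give `2 #(F \\ F)` sets of `cl T`; in the tight case the `≥ #D = #W` member witnesses of the core
  (`D` = the pure cross differences `w`, `U \ w` behind `W`) and their complements give `2 #W` more, each a term `p \ w` or `q ∩ w`.
* `two_mul_card_le_card_clU_scTerms_of_card_le_one` — the case `#W ≤ 1` is always tight-or-free (recovers gen 71).

What remains open of (Π2″) after this file: the MS-excess range `1 ≤ #(F \\ F) − #F < #W` (conjecturally covered by (MS2), memo §0).
-/

namespace Summit.CriticalPhenomena.PercolationContinuityZ3.Theorems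

namespace GeneratedDonors

open Finset FinsetFamily

variable {α : Type*} [DecidableEq α]


section PureSCTight

variable {U : Finset α}

/-- **(Π2″) for dead-like blocks, MS-tight or MS-free.**  `F = P ⊔ Q` pairwise intersecting and non-covering in `U`; `W` a
complement-free family of representatives avoiding `cl(P \\ P ∪ Q \\ Q)`; and either `#(F \\ F) = #F` (Marica–Schönheim tight)
or `#F + #W ≤ #(F \\ F)` (excess at least `#W`).  Then `2 (#P + #Q + #W) ≤ #clU U (scTerms P Q W)`. -/
theorem two_mul_card_le_card_clU_scTerms_of_tight_or_free (P Q W : Finset (Finset α))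
    (hU : ∀ a ∈ P ∪ Q, a ⊆ U) (hPQ : Disjoint P Q)
    (hint : ∀ a ∈ P ∪ Q, ∀ b ∈ P ∪ Q, (a ∩ b).Nonempty) (hcov : ∀ a ∈ P ∪ Q, ∀ b ∈ P ∪ Q, a ∪ b ≠ U)
    (hrep : W ⊆ scReps U P Q) (hWco : ∀ a ∈ W, ∀ b ∈ W, a ≠ U \ b)
    (hC2 : ∀ w ∈ W, w ∉ clU U ((P \\ P) ∪ (Q \\ Q)))
    (hex : #((P ∪ Q) \\ (P ∪ Q)) = #(P ∪ Q) ∨ #(P ∪ Q) + #W ≤ #((P ∪ Q) \\ (P ∪ Q))) :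
    2 * (#P + #Q + #W) ≤ #(clU U (scTerms P Q W)) := by
  classical
  set F := P ∪ Q with hFdef
  set T := scTerms P Q W with hTdef
  have hcardF : #F = #P + #Q := card_union_of_disjoint hPQ
  have hP : ∀ {a}, a ∈ P → a ∈ F := fun ha => mem_union_left _ ha
  have hQ : ∀ {a}, a ∈ Q → a ∈ F := fun ha => mem_union_right _ ha
  have hcc : ∀ {a : Finset α}, a ⊆ U → U \ (U \ a) = a := fun ha => Finset.sdiff_sdiff_eq_self ha
  have hWU : ∀ w ∈ W, w ⊆ U := fun w hw => subset_of_mem_scReps hU (hrep hw)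
  -- F \\ F ⊆ T and the closure of the differences
  have hdiffs_sub : F \\ F ⊆ T := by
    intro t ht
    obtain ⟨a, ha, b, hb, rfl⟩ := mem_diffs.mp ht
    rw [hTdef]; unfold scTerms
    simp only [mem_union]
    rcases mem_union.mp ha with ha | ha <;> rcases mem_union.mp hb with hb | hb
    · exact Or.inl (Or.inl (Or.inl (Or.inl (Or.inl (Or.inl (Or.inl (sdiff_mem_diffs ha hb)))))))
    · exact Or.inl (Or.inl (Or.inl (Or.inl (Or.inl (Or.inr (sdiff_mem_diffs ha hb))))))
    · exact Or.inl (Or.inl (Or.inl (Or.inl (Or.inr (sdiff_mem_diffs ha hb)))))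
    · exact Or.inl (Or.inl (Or.inl (Or.inl (Or.inl (Or.inl (Or.inr (sdiff_mem_diffs ha hb)))))))
  have hcl_mono : ∀ {S S' : Finset (Finset α)}, S ⊆ S' → clU U S ⊆ clU U S' := by
    intro S S' hSS' t ht
    rcases mem_clU.mp ht with h | ⟨s, hs, rfl⟩
    · exact mem_clU.mpr (Or.inl (hSS' h))
    · exact mem_clU.mpr (Or.inr ⟨s, hSS' hs, rfl⟩)
  have hsub : clU U (F \\ F) ⊆ clU U T := hcl_mono hdiffs_sub
  have hclcard : #(clU U (F \\ F)) = 2 * #(F \\ F) := card_clU_diffs F hU hcov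
  have hMS : #F ≤ #(F \\ F) := F.card_le_card_diffs
  -- the free case
  rcases hex with htight | hfree
  swap
  · have h2 := card_le_card hsub
    rw [hclcard] at h2
    omega
  -- the tight case: W = ∅ or F nonempty with a pivot
  rcases W.eq_empty_or_nonempty with hW0 | hWne
  · rw [hW0, card_empty, add_zero]
    have h2 := card_le_card hsub
    rw [hclcard] at h2
    omega
  have hne : F.Nonempty := by
    obtain ⟨w, hw⟩ := hWne
    have := hrep hw
    unfold scReps at this
    rcases mem_union.mp this with h | h
    · obtain ⟨a, ha, -, -, -⟩ := mem_diffs.mp h; exact ⟨a, hP ha⟩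
    · obtain ⟨pq, hpq, -⟩ := mem_image.mp h; exact ⟨pq.1, hP (mem_product.mp hpq).1⟩
  obtain ⟨c, hcF, hc⟩ := TwistedAD.exists_pivot_of_card_diffs_eq_card F htight hne
  have hcard : #(F \\ F) ≤ #F := htight.le
  -- the pure cross differences behind W
  set D := (F \\ F).filter fun d => d ∈ W ∨ U \ d ∈ W with hDdef
  have hD : D ⊆ F \\ F := filter_subset _ _
  have hDsub : ∀ t ∈ (P \\ P) ∪ (Q \\ Q), t ⊆ U := by
    intro t ht
    rcases mem_union.mp ht with ht | ht
    · obtain ⟨a, ha, b, -, rfl⟩ := mem_diffs.mp ht; exact sdiff_subset.trans (hU a (hP ha))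
    · obtain ⟨a, ha, b, -, rfl⟩ := mem_diffs.mp ht; exact sdiff_subset.trans (hU a (hQ ha))
  have hpure : ∀ d ∈ D, d ∉ P \\ P ∧ d ∉ Q \\ Q := by
    intro d hd
    obtain ⟨hdF, hdW⟩ := mem_filter.mp hd
    rcases hdW with h | h
    · exact ⟨fun h' => hC2 d h (mem_clU.mpr (Or.inl (mem_union_left _ h'))),
        fun h' => hC2 d h (mem_clU.mpr (Or.inl (mem_union_right _ h')))⟩
    · exact ⟨fun h' => hC2 _ h (mem_clU.mpr (Or.inr ⟨d, mem_union_left _ h', rfl⟩)),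
        fun h' => hC2 _ h (mem_clU.mpr (Or.inr ⟨d, mem_union_right _ h', rfl⟩))⟩
  -- #W ≤ #D : w ↦ its difference
  have hWD : #W ≤ #D := by
    refine card_le_card_of_injOn (fun w => if w ∈ F \\ F then w else U \ w) ?_ ?_
    · intro w hw
      have hw' := hrep (mem_coe.mp hw)
      simp only [mem_coe]
      by_cases hwd : w ∈ F \\ F
      · rw [if_pos hwd]; exact mem_filter.mpr ⟨hwd, Or.inl (mem_coe.mp hw)⟩
      · rw [if_neg hwd]
        unfold scReps at hw'
        rcases mem_union.mp hw' with h | h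
        · obtain ⟨a, ha, b, hb, rfl⟩ := mem_diffs.mp h
          exact absurd (mem_diffs.mpr ⟨a, hP ha, b, hQ hb, rfl⟩) hwd
        · obtain ⟨pq, hpq, hpqw⟩ := mem_image.mp h
          obtain ⟨hp₀, hq₀⟩ := mem_product.mp hpq
          have hq₀U : pq.2 ⊆ U := hU _ (hQ hq₀)
          have he_eq : U \ w = pq.2 \ pq.1 := by
            rw [← hpqw]
            ext i; simp only [mem_sdiff, mem_union]
            constructor
            · rintro ⟨hiU, h⟩
              refine ⟨?_, fun h1 => h (Or.inl h1)⟩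
              by_contra h2; exact h (Or.inr ⟨hiU, h2⟩)
            · rintro ⟨hi2, hi1⟩
              exact ⟨hq₀U hi2, fun h => h.elim hi1 (fun h' => h'.2 hi2)⟩
          refine mem_filter.mpr ⟨?_, Or.inr ?_⟩
          · rw [he_eq]; exact mem_diffs.mpr ⟨pq.2, hQ hq₀, pq.1, hP hp₀, rfl⟩
          · rw [hcc (hWU w (mem_coe.mp hw))]; exact mem_coe.mp hw
    · intro w hw w' hw' hww
      simp only at hww
      have hwU := hWU w (mem_coe.mp hw); have hw'U := hWU w' (mem_coe.mp hw')
      by_cases h1 : w ∈ F \\ F <;> by_cases h2 : w' ∈ F \\ F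
      · rwa [if_pos h1, if_pos h2] at hww
      · rw [if_pos h1, if_neg h2] at hww
        exact absurd hww (hWco w (mem_coe.mp hw) w' (mem_coe.mp hw'))
      · rw [if_neg h1, if_pos h2] at hww
        exact absurd hww.symm (hWco w' (mem_coe.mp hw') w (mem_coe.mp hw))
      · rw [if_neg h1, if_neg h2] at hww
        rw [← hcc hwU, hww, hcc hw'U]
  -- the witness members
  set Tm := F.filter fun m => ∃ d ∈ D, (∃ p ∈ P, p \ d = m) ∧ (∃ q ∈ Q, q \ d = m) with hTmdef
  have hcore : #D ≤ #Tm :=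
    card_le_card_filter_secondDiff_of_pivot rfl hcard hc hcF hD (fun d hd => (hpure d hd).1) fun d hd => (hpure d hd).2
  have hTmF : Tm ⊆ F := filter_subset _ _
  -- every witness member is a term: p \ w (type 5) or q ∩ w (type 2)
  have hTmT : Tm ⊆ T := by
    intro m hm
    obtain ⟨-, d, hdD, ⟨p, hp, hpd⟩, ⟨q, hq, hqd⟩⟩ := mem_filter.mp hm
    obtain ⟨-, hdW⟩ := mem_filter.mp hdD
    rw [hTdef]; unfold scTerms
    simp only [mem_union]
    rcases hdW with hw | hw
    · exact Or.inl (Or.inl (Or.inl (Or.inr (mem_diffs.mpr ⟨p, hp, d, hw, hpd⟩))))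
    · refine Or.inl (Or.inr (mem_infs.mpr ⟨q, hq, U \ d, hw, ?_⟩))
      rw [← hqd]
      show q ∩ (U \ d) = q \ d
      ext i; simp only [mem_inter, mem_sdiff]
      constructor
      · rintro ⟨hiq, -, hid⟩; exact ⟨hiq, hid⟩
      · rintro ⟨hiq, hid⟩; exact ⟨hiq, hU q (hQ hq) hiq, hid⟩
  -- members and their complements are 2 #Tm new sets
  have hTU : ∀ t ∈ T, t ⊆ U := by
    intro t ht
    rw [hTdef] at ht; unfold scTerms at ht
    simp only [mem_union] at ht
    have hPU : ∀ a ∈ P, a ⊆ U := fun a ha => hU a (hP ha)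
    have hQU : ∀ a ∈ Q, a ⊆ U := fun a ha => hU a (hQ ha)
    rcases ht with ((((((h | h) | h) | h) | h) | h) | h) | h
    · obtain ⟨a, ha, b, -, rfl⟩ := mem_diffs.mp h; exact sdiff_subset.trans (hPU a ha)
    · obtain ⟨a, ha, b, -, rfl⟩ := mem_diffs.mp h; exact sdiff_subset.trans (hQU a ha)
    · obtain ⟨a, ha, b, -, rfl⟩ := mem_diffs.mp h; exact sdiff_subset.trans (hPU a ha)
    · obtain ⟨a, ha, b, -, rfl⟩ := mem_diffs.mp h; exact sdiff_subset.trans (hQU a ha)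
    · obtain ⟨a, ha, b, -, rfl⟩ := mem_diffs.mp h; exact sdiff_subset.trans (hPU a ha)
    · obtain ⟨a, ha, b, -, rfl⟩ := mem_diffs.mp h; exact sdiff_subset.trans (hWU a ha)
    · obtain ⟨a, ha, b, -, rfl⟩ := mem_infs.mp h; exact inter_subset_left.trans (hQU a ha)
    · obtain ⟨a, ha, b, hb, rfl⟩ := mem_sups.mp h; exact union_subset (hQU a ha) (hWU b hb)
  set Tc := Tm.image fun m => U \ m with hTcdef
  have hTm_cl : Tm ⊆ clU U T := fun m hm => mem_clU.mpr (Or.inl (hTmT hm))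
  have hTc_cl : Tc ⊆ clU U T := by
    intro t ht
    obtain ⟨m, hm, rfl⟩ := mem_image.mp ht
    exact mem_clU.mpr (Or.inr ⟨m, hTmT hm, rfl⟩)
  have hcardTc : #Tc = #Tm := by
    refine card_image_of_injOn ?_
    intro m hm m' hm' hmm
    have hmU : m ⊆ U := hU m (hTmF (mem_coe.mp hm))
    have hm'U : m' ⊆ U := hU m' (hTmF (mem_coe.mp hm'))
    simp only at hmm
    rw [← hcc hmU, hmm, hcc hm'U]
  have hdisj1 : Disjoint Tm Tc := by
    rw [Finset.disjoint_left]
    intro m hm hmc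
    obtain ⟨m', hm', hmm⟩ := mem_image.mp hmc
    obtain ⟨i, hi⟩ := hint m (hTmF hm) m' (hTmF hm')
    rw [mem_inter, ← hmm, mem_sdiff] at hi
    exact hi.1.2 hi.2
  have hnot1 : ∀ m ∈ Tm, m ∉ clU U (F \\ F) := fun m hm => notMem_clU_diffs_of_mem hU hint hcov (hTmF hm)
  have hdS : ∀ t ∈ F \\ F, t ⊆ U := by
    intro t ht
    obtain ⟨a, ha, b, -, rfl⟩ := mem_diffs.mp ht
    exact sdiff_subset.trans (hU a ha)
  have hnot2 : ∀ t ∈ Tc, t ∉ clU U (F \\ F) := by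
    intro t ht h
    obtain ⟨m, hm, rfl⟩ := mem_image.mp ht
    have := compl_mem_clU hdS sdiff_subset h
    rw [hcc (hU m (hTmF hm))] at this
    exact hnot1 m hm this
  have hdisj2 : Disjoint (clU U (F \\ F)) (Tm ∪ Tc) := by
    rw [Finset.disjoint_right]
    intro t ht
    rcases mem_union.mp ht with h | h
    · exact hnot1 t h
    · exact hnot2 t h
  have hbig : clU U (F \\ F) ∪ (Tm ∪ Tc) ⊆ clU U T := union_subset hsub (union_subset hTm_cl hTc_cl)
  have hcount := card_le_card hbig
  rw [card_union_of_disjoint hdisj2, card_union_of_disjoint hdisj1, hclcard, hcardTc, htight, hcardF] at hcount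
  omega

/-- **Corollary: at most one blocker** (the single-blocker theorem of gen 71, now a special case): with `#W ≤ 1` the family
`F = P ⊔ Q` is always MS-tight or has excess `≥ #W`. -/
theorem two_mul_card_le_card_clU_scTerms_of_card_le_one (P Q W : Finset (Finset α))
    (hU : ∀ a ∈ P ∪ Q, a ⊆ U) (hPQ : Disjoint P Q)
    (hint : ∀ a ∈ P ∪ Q, ∀ b ∈ P ∪ Q, (a ∩ b).Nonempty) (hcov : ∀ a ∈ P ∪ Q, ∀ b ∈ P ∪ Q, a ∪ b ≠ U)
    (hrep : W ⊆ scReps U P Q) (hWco : ∀ a ∈ W, ∀ b ∈ W, a ≠ U \ b)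
    (hC2 : ∀ w ∈ W, w ∉ clU U ((P \\ P) ∪ (Q \\ Q))) (hW : #W ≤ 1) :
    2 * (#P + #Q + #W) ≤ #(clU U (scTerms P Q W)) := by
  refine two_mul_card_le_card_clU_scTerms_of_tight_or_free P Q W hU hPQ hint hcov hrep hWco hC2 ?_
  have hMS : #(P ∪ Q) ≤ #((P ∪ Q) \\ (P ∪ Q)) := (P ∪ Q).card_le_card_diffs
  omega

end PureSCTight

end GeneratedDonors

end Summit.CriticalPhenomena.PercolationContinuityZ3.Theorems
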